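import Mathlib
import HarnessLib
import Summits.AtomisticToContinuum.FouriersLaw.Theses.JunctionLocality
import Summits.AtomisticToContinuum.FouriersLaw.Theorems.JunctionLocalityDefs
import Summits.AtomisticToContinuum.FouriersLaw.Theorems.JunctionLocalityNonBallisticProfileUniformBound
import Summits.AtomisticToContinuum.FouriersLaw.Theorems.OddSectorIrreversibilityConeScaleCorrectorStubCentredCorrector
import Summits.AtomisticToContinuum.FouriersLaw.Theorems.BondHeatUncertaintySubdiffusiveBondHeatKernelDetailedBalance

/-!
# Crux `ConductanceLowerBound` (stmt-AtomisticToContinuum-11749), line `kick-dipole-no-collapse`, stub (E) — helper 1: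
# the fixed-`N` parity identities of the kick-response kernel

Helper file toward the registered stub `stub_escapeFloor` (E) of the line (lead c1).  For the pinned anharmonic chain
`P = pinnedChain ω₂ lam β γ` (all parameters `> 0`), `T > 0`, `N ≥ 1` and EVERY real time `s`, the kick-response
kernel `𝒥_N(s) = kickKernel P N T s = T⁻² ∫ g · (κ_s J) dμ_T` of `Theorems/JunctionLocalityDefs.lean`
(`g = kdnSource = (γ/2)(p_0² − p_{N−1}²)`, `J = totalCurrentObs = Σ_i j_i`, `κ_s = evolve` the constructed
equal-temperature kernels, `μ_T = gibbsMeasure`) satisfies the two exact symmetries everybody on the line uses: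

* `helper_kdKickKernelHalving` — **reflection halving and centring**:
  `𝒥_N(s) = (γ/T²) ∫ (p_0² − T) · (κ_s J) dμ_T`.
  The site reflection `R : i ↦ N−1−i` preserves `μ_T` (`NonBallistic.measurePreserving_siteReflection_gibbsMeasure`),
  maps `p_{N−1}² ↦ p_0²` and `κ_s J ↦ −κ_s J` (`OddSectorWitness.kernelAverage_sum_bondCurrent_siteReflection`: the
  equal-temperature kernels are reflection covariant and `J ∘ R = −J`), so the two halves of `g` contribute equally;
  and `∫ κ_s J dμ_T = ∫ J dμ_T = 0` (Gibbs invariance of the kernels, no current at equilibrium) centres `p_0²`.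
* `helper_kdKickKernelRegression` — **the time-reversed (regression) reading**:
  `𝒥_N(s) = −T⁻² ∫ J · (κ_s g) dμ_T = −(γ/T²) ∫ J · κ_s(p_0² − T) dμ_T`
  by the landed kernel detailed balance `κ_s† = Θ κ_s Θ` on `L²(μ_T)` (`SubdiffusiveBondHeat.pinnedChain_detailedBalance`,
  Rey-Bellet 2006 Lemma 4.2), `g ∘ Θ = g`, `J ∘ Θ = −J`: the kernel is minus the mean kinetic excess at the left contact a
  time `s` AFTER a total-current fluctuation.
* `kickKernel_of_nonpos` — `𝒥_N(s) = 0` for `s ≤ 0` (`κ_s = id` and `∫ g J dμ_T = 0` by momentum parity).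

All statements are fixed-`N` bookkeeping over proved tree facts (no named fact, no hypothesis of the crux is used).
-/

noncomputable section

open MeasureTheory ProbabilityTheory Filter Topology Set
open scoped NNReal ENNReal BigOperators
open Literature.MathematicalPhysics.KineticTheory.HeatConduction
open Summit.AtomisticToContinuum.FouriersLaw.Theorems.JunctionLocality
open Summit.AtomisticToContinuum.FouriersLaw.Theorems

namespace Summit.AtomisticToContinuum.FouriersLaw.Cruxes.ConductanceLowerBound.KickDipoleNoCollapse

variable {N : ℕ}

/-! ### Elementary facts on the vocabulary -/

/-- `κ_s J` unfolded to the tree's kernels. -/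
theorem evolve_totalCurrentObs_eq (P : OscillatorChain) (N : ℕ) (T s : ℝ) (z : PhaseSpace N) :
    evolve P N T (totalCurrentObs P N) s z =
      ∫ y, (∑ i : Fin N, P.bondCurrent N i y) ∂(P.transitionKernel N T T s.toNNReal z) := rfl

/-- The total current is odd under the momentum flip. -/
theorem totalCurrentObs_neg_momentum (P : OscillatorChain) (N : ℕ) (z : PhaseSpace N) :
    totalCurrentObs P N (z.1, -z.2) = -totalCurrentObs P N z := by
  simp only [totalCurrentObs, OscillatorChain.bondCurrent_neg_momentum, Finset.sum_neg_distrib]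

/-- The KDN source is continuous. -/
theorem continuous_kdnSource (P : OscillatorChain) (N : ℕ) : Continuous (kdnSource P N) := by
  unfold kdnSource
  split_ifs
  · fun_prop
  · exact continuous_const

/-- The KDN source under the site reflection: `g ∘ R = −g`. -/
theorem kdnSource_siteReflection (P : OscillatorChain) (N : ℕ) (z : PhaseSpace N) :
    kdnSource P N (siteReflection N z) = -kdnSource P N z := by
  unfold kdnSource
  split_ifs with h
  · have h0 : Fin.rev (⟨0, h⟩ : Fin N) = ⟨N - 1, by omega⟩ := by
      ext; simp only [Fin.val_rev]
    have h1 : Fin.rev (⟨N - 1, by omega⟩ : Fin N) = ⟨0, h⟩ := by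
      ext; simp only [Fin.val_rev]; omega
    simp only [siteReflection_snd, h0, h1]
    ring
  · simp

section Pinned

variable {ω₂ lam β γ : ℝ} (hω : 0 < ω₂) (hl : 0 < lam) (hβ : 0 < β) (hγ : 0 < γ) (hN : 0 < N) {T : ℝ} (hT : 0 < T)
include hω hl hβ hγ hN hT

/-- **`L²(μ_T)` facts for the evolved total current `κ_s J`** (every real `s`): it is strongly measurable, square
integrable and integrable against `μ_T`, and centred, `∫ κ_s J dμ_T = 0` (Gibbs invariance of the kernels and no current
at equilibrium); `J` itself is square integrable. -/
theorem evolve_totalCurrentObs_facts (s : ℝ) :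
    StronglyMeasurable (evolve (pinnedChain ω₂ lam β γ) N T (totalCurrentObs (pinnedChain ω₂ lam β γ) N) s) ∧
    Integrable (fun z => (evolve (pinnedChain ω₂ lam β γ) N T (totalCurrentObs (pinnedChain ω₂ lam β γ) N) s z) ^ 2)
      ((pinnedChain ω₂ lam β γ).gibbsMeasure N T) ∧
    Integrable (evolve (pinnedChain ω₂ lam β γ) N T (totalCurrentObs (pinnedChain ω₂ lam β γ) N) s)
      ((pinnedChain ω₂ lam β γ).gibbsMeasure N T) ∧
    ∫ z, evolve (pinnedChain ω₂ lam β γ) N T (totalCurrentObs (pinnedChain ω₂ lam β γ) N) s z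
      ∂((pinnedChain ω₂ lam β γ).gibbsMeasure N T) = 0 ∧
    Integrable (fun z => (totalCurrentObs (pinnedChain ω₂ lam β γ) N z) ^ 2) ((pinnedChain ω₂ lam β γ).gibbsMeasure N T) := by
  set P := pinnedChain ω₂ lam β γ with hP
  haveI : IsProbabilityMeasure (P.gibbsMeasure N T) := pinnedChain_isProbabilityMeasure_gibbsMeasure hω hl.le hβ.le γ N hT
  obtain ⟨hϑ0, h2ϑ⟩ := LightConeBondHeat.quarter_inv_temp_admissible hT
  have hJc : Continuous (totalCurrentObs P N) := OddSectorIrreversibility.continuous_totalBondCurrent ω₂ lam β γ N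
  have hJb : ∀ y : PhaseSpace N, |totalCurrentObs P N y| ≤
      N * (N * ((3 + β) / 2) * (2 * Real.exp (1 / (4 * T)) / (1 / (4 * T)) ^ 2)) *
        Real.exp (1 / (4 * T) * P.hamiltonian N y) :=
    OddSectorIrreversibility.abs_totalBondCurrent_le_exp hω.le hl.le hβ.le γ N hϑ0
  obtain ⟨hJ2, hPJ2, -⟩ := SubdiffusiveBondHeat.pinnedChain_integral_sq_act_le hω hl.le hβ hγ hN hT hϑ0 h2ϑ hJc hJb
    s.toNNReal
  have hsm : StronglyMeasurable (evolve P N T (totalCurrentObs P N) s) :=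
    hJc.stronglyMeasurable.integral_kernel (κ := P.transitionKernel N T T s.toNNReal)
  have hint : Integrable (evolve P N T (totalCurrentObs P N) s) (P.gibbsMeasure N T) :=
    ((memLp_two_iff_integrable_sq hsm.aestronglyMeasurable).2 hPJ2).integrable one_le_two
  have hJint : Integrable (totalCurrentObs P N) (P.gibbsMeasure N T) :=
    ((memLp_two_iff_integrable_sq hJc.aestronglyMeasurable).2 hJ2).integrable one_le_two
  refine ⟨hsm, hPJ2, hint, ?_, hJ2⟩
  have h1 := SubdiffusiveBondHeat.pinnedChain_integral_transitionKernel_gibbsMeasure hω hl.le hβ.le hγ.le hN hT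
    s.toNNReal hJint
  have h0 : ∫ y, totalCurrentObs P N y ∂(P.gibbsMeasure N T) = 0 :=
    OddSectorIrreversibility.integral_totalBondCurrent_gibbsMeasure hω hl.le hβ.le γ N hT
  rw [h0] at h1
  exact h1

/-- **`L²(μ_T)` facts for the kinetic excess `k_i = p_i² − T`**: continuous, `|k_i| ≤ (8T + T) e^{H/(4T)}`,
`k_i² ∈ L¹(μ_T)`, and `k_i · F ∈ L¹(μ_T)` for every strongly measurable `F` with `F² ∈ L¹(μ_T)`. -/
theorem kinExcess_facts (i : Fin N) :
    Continuous (fun z : PhaseSpace N => z.2 i ^ 2 - T) ∧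
    Integrable (fun z : PhaseSpace N => (z.2 i ^ 2 - T) ^ 2) ((pinnedChain ω₂ lam β γ).gibbsMeasure N T) ∧
    ∀ F : PhaseSpace N → ℝ, StronglyMeasurable F →
      Integrable (fun z => F z ^ 2) ((pinnedChain ω₂ lam β γ).gibbsMeasure N T) →
      Integrable (fun z : PhaseSpace N => (z.2 i ^ 2 - T) * F z) ((pinnedChain ω₂ lam β γ).gibbsMeasure N T) := by
  set P := pinnedChain ω₂ lam β γ with hP
  obtain ⟨hϑ0, h2ϑ⟩ := LightConeBondHeat.quarter_inv_temp_admissible hT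
  have hkc : Continuous (fun z : PhaseSpace N => z.2 i ^ 2 - T) := by fun_prop
  have hkb : ∀ z : PhaseSpace N, |z.2 i ^ 2 - T| ≤ (2 / (1 / (4 * T)) + T) * Real.exp (1 / (4 * T) * P.hamiltonian N z) :=
    fun z => SubdiffusiveBondHeat.abs_sq_momentum_sub_le_exp hω hl.le hβ.le hϑ0 hT.le z i
  obtain ⟨hk2, -, -⟩ := SubdiffusiveBondHeat.pinnedChain_integral_sq_act_le hω hl.le hβ hγ hN hT hϑ0 h2ϑ hkc hkb 0
  refine ⟨hkc, hk2, fun F hFm hF2 => ?_⟩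
  exact SubdiffusiveBondHeat.integrable_mul_of_sq_aesm hkc.aestronglyMeasurable hFm.aestronglyMeasurable hk2 hF2

/-- **`p_i² · F ∈ L¹(μ_T)`** for strongly measurable `F` with `F² ∈ L¹(μ_T)` (from `kinExcess_facts` and `F ∈ L¹`). -/
theorem integrable_sq_momentum_mul (i : Fin N) {F : PhaseSpace N → ℝ} (hFm : StronglyMeasurable F)
    (hF2 : Integrable (fun z => F z ^ 2) ((pinnedChain ω₂ lam β γ).gibbsMeasure N T)) :
    Integrable (fun z : PhaseSpace N => z.2 i ^ 2 * F z) ((pinnedChain ω₂ lam β γ).gibbsMeasure N T) := by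
  haveI : IsProbabilityMeasure ((pinnedChain ω₂ lam β γ).gibbsMeasure N T) :=
    pinnedChain_isProbabilityMeasure_gibbsMeasure hω hl.le hβ.le γ N hT
  obtain ⟨-, -, hk⟩ := kinExcess_facts hω hl hβ hγ hN hT i
  have h1 := hk F hFm hF2
  have hF : Integrable F ((pinnedChain ω₂ lam β γ).gibbsMeasure N T) :=
    ((memLp_two_iff_integrable_sq hFm.aestronglyMeasurable).2 hF2).integrable one_le_two
  have h2 := h1.add (hF.const_mul T)
  refine h2.congr (Eventually.of_forall fun z => ?_)
  simp only [Pi.add_apply]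
  ring

/-! ### (1a) Reflection halving: the far half mirrors the near half -/

omit hT in
/-- **The far half of the source mirrors the near half**: `∫ p_{N−1}² · (κ_s J) dμ_T = −∫ p_0² · (κ_s J) dμ_T`
(`R_* μ_T = μ_T`, `p_{N−1} ∘ R = p_0`, `(κ_s J) ∘ R = −κ_s J`). -/
theorem integral_far_sq_momentum_mul_evolve (s : ℝ) :
    ∫ z, z.2 ⟨N - 1, by omega⟩ ^ 2 * evolve (pinnedChain ω₂ lam β γ) N T (totalCurrentObs (pinnedChain ω₂ lam β γ) N) s z
        ∂((pinnedChain ω₂ lam β γ).gibbsMeasure N T) =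
      -∫ z, z.2 ⟨0, hN⟩ ^ 2 * evolve (pinnedChain ω₂ lam β γ) N T (totalCurrentObs (pinnedChain ω₂ lam β γ) N) s z
        ∂((pinnedChain ω₂ lam β γ).gibbsMeasure N T) := by
  set P := pinnedChain ω₂ lam β γ with hP
  have hR := NonBallistic.measurePreserving_siteReflection_gibbsMeasure P (pinnedChain_V_neg ω₂ lam β γ) N T
  have h1 : Fin.rev (⟨N - 1, by omega⟩ : Fin N) = ⟨0, hN⟩ := by
    ext; simp only [Fin.val_rev]; omega
  have hodd : ∀ z, evolve P N T (totalCurrentObs P N) s (siteReflection N z) = -evolve P N T (totalCurrentObs P N) s z := by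
    intro z
    rw [evolve_totalCurrentObs_eq, evolve_totalCurrentObs_eq]
    exact OddSectorWitness.kernelAverage_sum_bondCurrent_siteReflection hω hl.le hβ.le hγ.le N T s.toNNReal z
  have h := hR.integral_comp (siteReflectionEquiv N).measurableEmbedding
    (fun z => z.2 ⟨N - 1, by omega⟩ ^ 2 * evolve P N T (totalCurrentObs P N) s z)
  rw [← h, ← integral_neg]
  refine integral_congr_ae (Eventually.of_forall fun z => ?_)
  show (siteReflection N z).2 ⟨N - 1, _⟩ ^ 2 * evolve P N T (totalCurrentObs P N) s (siteReflection N z) = _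
  rw [siteReflection_snd, h1, hodd z]
  ring

/-- **The KDN source is square integrable** against `μ_T` (`g = (γ/2)(k_0 − k_{N−1})`, `k_i = p_i² − T`). -/
theorem integrable_sq_kdnSource :
    Integrable (fun z => kdnSource (pinnedChain ω₂ lam β γ) N z ^ 2) ((pinnedChain ω₂ lam β γ).gibbsMeasure N T) := by
  set P := pinnedChain ω₂ lam β γ with hP
  obtain ⟨-, hk02, -⟩ := kinExcess_facts hω hl hβ hγ hN hT ⟨0, hN⟩
  obtain ⟨-, hkL2, -⟩ := kinExcess_facts hω hl hβ hγ hN hT ⟨N - 1, by omega⟩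
  have hgeq : ∀ z : PhaseSpace N, kdnSource P N z = γ / 2 * ((z.2 ⟨0, hN⟩ ^ 2 - T) - (z.2 ⟨N - 1, by omega⟩ ^ 2 - T)) := by
    intro z; rw [kdnSource_of_pos P hN]; show γ / 2 * _ = _; ring
  have hdom : Integrable (fun z : PhaseSpace N => (γ / 2) ^ 2 * (2 * (z.2 ⟨0, hN⟩ ^ 2 - T) ^ 2 + 2 * (z.2 ⟨N - 1, by omega⟩ ^ 2 - T) ^ 2))
      (P.gibbsMeasure N T) := ((hk02.const_mul 2).add (hkL2.const_mul 2)).const_mul _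
  refine hdom.mono' ((continuous_kdnSource P N).pow 2).aestronglyMeasurable (Eventually.of_forall fun z => ?_)
  rw [Real.norm_eq_abs, abs_of_nonneg (sq_nonneg _), hgeq z, mul_pow]
  refine mul_le_mul_of_nonneg_left ?_ (sq_nonneg _)
  nlinarith [sq_nonneg ((z.2 ⟨0, hN⟩ ^ 2 - T) + (z.2 ⟨N - 1, by omega⟩ ^ 2 - T))]

/-- **Detailed balance for an even source against the odd current**: for a measurable, momentum-even `f` with
`f² ∈ L¹(μ_T)`, `∫ f · (κ_s J) dμ_T = −∫ J · (κ_s f) dμ_T` (`SubdiffusiveBondHeat.pinnedChain_detailedBalance`,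
`J ∘ Θ = −J`). -/
theorem integral_even_mul_evolve_totalCurrentObs {f : PhaseSpace N → ℝ} (hfm : Measurable f)
    (hfe : ∀ z : PhaseSpace N, f (z.1, -z.2) = f z)
    (hf2 : Integrable (fun z => f z ^ 2) ((pinnedChain ω₂ lam β γ).gibbsMeasure N T)) (s : ℝ) :
    ∫ z, f z * evolve (pinnedChain ω₂ lam β γ) N T (totalCurrentObs (pinnedChain ω₂ lam β γ) N) s z
        ∂((pinnedChain ω₂ lam β γ).gibbsMeasure N T) =
      -∫ z, totalCurrentObs (pinnedChain ω₂ lam β γ) N z * evolve (pinnedChain ω₂ lam β γ) N T f s z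
        ∂((pinnedChain ω₂ lam β γ).gibbsMeasure N T) := by
  set P := pinnedChain ω₂ lam β γ with hP
  obtain ⟨-, -, -, -, hJ2⟩ := evolve_totalCurrentObs_facts hω hl hβ hγ hN hT s
  have hJm : Measurable (totalCurrentObs P N) := (OddSectorIrreversibility.continuous_totalBondCurrent ω₂ lam β γ N).measurable
  have hdb := SubdiffusiveBondHeat.pinnedChain_detailedBalance hω hl hβ hγ hN hT hfm hJm hf2 hJ2 s.toNNReal
  have h1 : ∫ z, f z * evolve P N T (totalCurrentObs P N) s z ∂(P.gibbsMeasure N T) =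
      ∫ z, f z * (∫ y, totalCurrentObs P N y ∂(P.transitionKernel N T T s.toNNReal z)) ∂(P.gibbsMeasure N T) := rfl
  rw [h1, hdb, ← integral_neg]
  refine integral_congr_ae (Eventually.of_forall fun z => ?_)
  dsimp only
  rw [totalCurrentObs_neg_momentum]
  simp only [hfe]
  rw [neg_mul]
  rfl

end Pinned

/-! ### (1a) Reflection halving and centring -/

/-- **helper (1a) — REFLECTION HALVING AND CENTRING of the kick-response kernel.**  For the pinned anharmonic chain (all
parameters `> 0`), `T > 0`, `N ≥ 1` and every real `s`:
`kickKernel P N T s = (γ/T²) ∫ (p_0² − T) · (κ_s J) dμ_T` — the two halves of the antisymmetric source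
`g = (γ/2)(p_0² − p_{N−1}²)` contribute equally (left–right reflection covariance of the equal-temperature kernels,
`J ∘ R = −J`, `R_* μ_T = μ_T`), and `p_0²` may be centred because `∫ κ_s J dμ_T = ∫ J dμ_T = 0`.  So `𝒥_N` is
`γ/T²` times the equilibrium covariance of the kinetic excess at the injecting contact with the total current a time
`s` later. -/
theorem helper_kdKickKernelHalving : ∀ ω₂ lam β γ : ℝ, 0 < ω₂ → 0 < lam → 0 < β → 0 < γ → ∀ T : ℝ, 0 < T → ∀ (N : ℕ) (hN : 0 < N) (s : ℝ), kickKernel (pinnedChain ω₂ lam β γ) N T s = γ / T ^ 2 * ∫ z, (z.2 ⟨0, hN⟩ ^ 2 - T) * evolve (pinnedChain ω₂ lam β γ) N T (totalCurrentObs (pinnedChain ω₂ lam β γ) N) s z ∂((pinnedChain ω₂ lam β γ).gibbsMeasure N T) := by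
  intro ω₂ lam β γ hω hl hβ hγ T hT N hN s
  set P := pinnedChain ω₂ lam β γ with hP
  set F := evolve P N T (totalCurrentObs P N) s with hF
  obtain ⟨hFm, hF2, hFi, hF0, -⟩ := evolve_totalCurrentObs_facts hω hl hβ hγ hN hT s
  have hi0 := integrable_sq_momentum_mul hω hl hβ hγ hN hT ⟨0, hN⟩ hFm hF2
  have hiL := integrable_sq_momentum_mul hω hl hβ hγ hN hT ⟨N - 1, by omega⟩ hFm hF2
  have hfar := integral_far_sq_momentum_mul_evolve hω hl hβ hγ hN s (T := T)
  -- unfold the kernel: `𝒥 = T⁻² ∫ g F`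
  have hkick : kickKernel P N T s = 1 / T ^ 2 * ∫ z, kdnSource P N z * F z ∂(P.gibbsMeasure N T) := rfl
  have hg : ∀ z, kdnSource P N z * F z = γ / 2 * (z.2 ⟨0, hN⟩ ^ 2 * F z - z.2 ⟨N - 1, by omega⟩ ^ 2 * F z) := by
    intro z
    rw [kdnSource_of_pos P hN]
    show γ / 2 * (z.2 ⟨0, hN⟩ ^ 2 - z.2 ⟨N - 1, _⟩ ^ 2) * F z = _
    ring
  have hsplit : ∫ z, kdnSource P N z * F z ∂(P.gibbsMeasure N T) =
      γ * ∫ z, z.2 ⟨0, hN⟩ ^ 2 * F z ∂(P.gibbsMeasure N T) := by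
    rw [integral_congr_ae (Eventually.of_forall hg), integral_const_mul, integral_sub hi0 hiL, hfar]
    ring
  have hcentre : ∫ z, z.2 ⟨0, hN⟩ ^ 2 * F z ∂(P.gibbsMeasure N T) = ∫ z, (z.2 ⟨0, hN⟩ ^ 2 - T) * F z ∂(P.gibbsMeasure N T) := by
    have he : ∀ z, (z.2 ⟨0, hN⟩ ^ 2 - T) * F z = z.2 ⟨0, hN⟩ ^ 2 * F z - T * F z := fun z => by ring
    rw [integral_congr_ae (Eventually.of_forall he), integral_sub hi0 (hFi.const_mul T), integral_const_mul, hF0]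
    ring
  rw [hkick, hsplit, hcentre]
  ring

/-! ### (1c) The regression reading (kernel detailed balance) -/

/-- **helper (1c) — THE REGRESSION (time-reversed) READING.**  For the pinned anharmonic chain (all parameters `> 0`),
`T > 0`, `N ≥ 1` and every real `s`:
`kickKernel P N T s = −T⁻² ∫ J · (κ_s g) dμ_T` and `= −(γ/T²) ∫ J · κ_s(p_0² − T) dμ_T`:
by kernel detailed balance `∫ f (κ_s h) dμ_T = ∫ (h∘Θ) κ_s(f∘Θ) dμ_T` (`Θ(q,p) = (q,−p)`, landed
`SubdiffusiveBondHeat.pinnedChain_detailedBalance`) with the even sources `g`, `p_0² − T` and the odd current `J`: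
the kernel is minus the mean (kinetic) contact kick a time `s` AFTER a total-current fluctuation. -/
theorem helper_kdKickKernelRegression : ∀ ω₂ lam β γ : ℝ, 0 < ω₂ → 0 < lam → 0 < β → 0 < γ → ∀ T : ℝ, 0 < T → ∀ (N : ℕ) (hN : 0 < N) (s : ℝ), kickKernel (pinnedChain ω₂ lam β γ) N T s = -(1 / T ^ 2) * ∫ z, totalCurrentObs (pinnedChain ω₂ lam β γ) N z * evolve (pinnedChain ω₂ lam β γ) N T (kdnSource (pinnedChain ω₂ lam β γ) N) s z ∂((pinnedChain ω₂ lam β γ).gibbsMeasure N T) ∧ kickKernel (pinnedChain ω₂ lam β γ) N T s = -(γ / T ^ 2) * ∫ z, totalCurrentObs (pinnedChain ω₂ lam β γ) N z * evolve (pinnedChain ω₂ lam β γ) N T (fun y : PhaseSpace N => y.2 ⟨0, hN⟩ ^ 2 - T) s z ∂((pinnedChain ω₂ lam β γ).gibbsMeasure N T) := by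
  intro ω₂ lam β γ hω hl hβ hγ T hT N hN s
  set P := pinnedChain ω₂ lam β γ with hP
  obtain ⟨hk0c, hk02, -⟩ := kinExcess_facts hω hl hβ hγ hN hT ⟨0, hN⟩
  have hg := integral_even_mul_evolve_totalCurrentObs hω hl hβ hγ hN hT (continuous_kdnSource P N).measurable
    (kdnSource_neg_momentum P N) (integrable_sq_kdnSource hω hl hβ hγ hN hT) s
  have hk := integral_even_mul_evolve_totalCurrentObs hω hl hβ hγ hN hT hk0c.measurable
    (fun z => by simp only [Pi.neg_apply, neg_sq]) hk02 s
  constructor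
  · have hkick : kickKernel P N T s = 1 / T ^ 2 * ∫ z, kdnSource P N z * evolve P N T (totalCurrentObs P N) s z
        ∂(P.gibbsMeasure N T) := rfl
    rw [hkick, hg]
    ring
  · rw [helper_kdKickKernelHalving ω₂ lam β γ hω hl hβ hγ T hT N hN s, hk]
    ring

/-! ### `𝒥_N(s) = 0` before the kick acts -/

/-- **`𝒥_N(s) = 0` for `s ≤ 0`**: the kernel is the identity (`pinnedChain_evolve_of_nonpos`) and `∫ g J dμ_T = 0`
(detailed balance at time `s⁺ = 0` reads `∫ g J = −∫ J g`). -/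
theorem kickKernel_of_nonpos {ω₂ lam β γ : ℝ} (hω : 0 < ω₂) (hl : 0 < lam) (hβ : 0 < β) (hγ : 0 < γ) {N : ℕ} (hN : 0 < N)
    {T : ℝ} (hT : 0 < T) {s : ℝ} (hs : s ≤ 0) : kickKernel (pinnedChain ω₂ lam β γ) N T s = 0 := by
  set P := pinnedChain ω₂ lam β γ with hP
  obtain ⟨h1, -⟩ := helper_kdKickKernelRegression ω₂ lam β γ hω hl hβ hγ T hT N hN s
  have h2 : kickKernel P N T s = 1 / T ^ 2 * ∫ z, kdnSource P N z * evolve P N T (totalCurrentObs P N) s z ∂(P.gibbsMeasure N T) := rfl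
  have h3 : ∀ z, totalCurrentObs P N z * evolve P N T (kdnSource P N) s z = kdnSource P N z * evolve P N T (totalCurrentObs P N) s z := by
    intro z
    rw [pinnedChain_evolve_of_nonpos hω hl.le hβ.le hγ.le N T _ hs, pinnedChain_evolve_of_nonpos hω hl.le hβ.le hγ.le N T _ hs]
    ring
  rw [integral_congr_ae (Eventually.of_forall h3)] at h1
  have h4 : (1 / T ^ 2 + 1 / T ^ 2) * ∫ z, kdnSource P N z * evolve P N T (totalCurrentObs P N) s z ∂(P.gibbsMeasure N T) = 0 := by
    linarith
  have hT2 : (1 / T ^ 2 + 1 / T ^ 2) ≠ 0 := by positivity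
  rw [h2, (mul_eq_zero.1 h4).resolve_left hT2, mul_zero]

/-- **The booked dipole vanishes at nonpositive times**: `𝔇_N(t) = 0` for `t ≤ 0`. -/
theorem bookedDipole_of_nonpos {ω₂ lam β γ : ℝ} (hω : 0 < ω₂) (hl : 0 < lam) (hβ : 0 < β) (hγ : 0 < γ) {N : ℕ} (hN : 0 < N)
    {T : ℝ} (hT : 0 < T) {t : ℝ} (ht : t ≤ 0) : bookedDipole (pinnedChain ω₂ lam β γ) N T t = 0 := by
  rw [bookedDipole_def, intervalIntegral.integral_symm, intervalIntegral.integral_of_le ht]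
  rw [setIntegral_congr_fun measurableSet_Ioc (g := fun _ => (0 : ℝ)) fun s hs =>
    kickKernel_of_nonpos hω hl hβ hγ hN hT hs.2]
  simp

end Summit.AtomisticToContinuum.FouriersLaw.Cruxes.ConductanceLowerBound.KickDipoleNoCollapse

end
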